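import Literature.NumberTheory.Transcendental.NesterenkoEliminationProp47Proofs
import Literature.NumberTheory.Transcendental.NesterenkoBlockDehom
import Literature.NumberTheory.Transcendental.NesterenkoIntegerHeights
import Literature.NumberTheory.Transcendental.NesterenkoEliminationFacts2Proofs
import Literature.NumberTheory.DiophantineGeometry.GelfondLemma
import HarnessLib

/-!
# LNM 1752 Ch. 3 Proposition 4.7 2) (heights) from Proposition 4.4 — proofs only

Topic `Literature/NumberTheory/Transcendental`. Proofs-only sibling of
`NesterenkoEliminationFacts.lean`; no definitions, no named facts. Main result:

* `sum_primaryExponent_mul_iheight_le` — **Proposition 4.7 2)** of Nesterenko's "algebraic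
  fundamentals" (LNM 1752 Ch. 3 §4, p. 39, `K = ℚ`, `ν = 1`): for a homogeneous unmixed ideal
  `I ⊂ ℚ[x₀, …, x_m]` with `dim I = r − 1`, `1 ≤ r ≤ m`, reduced primary decomposition `t` and
  exponents `k_Q`, `∑_Q k_Q h(√Q) ≤ h(I) + m² deg I` — CONDITIONALLY on Proposition 4.4 taken as
  the hypothesis `(h44 : NesterenkoPhilippon2001_ch3_prop_4_4)`.

## The proof (the book refers to [Nes10, Prop. 1.2]; we follow the classical route)

1. Proposition 4.4 (`exists_chowForm_eq_C_mul_prod`): `F_I = c ∏_Q F_Q^{k_Q}` with `c ∈ ℚˣ`,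
   `F_Q` the associated form of `√Q`, all non-zero; `h(I) = h(F_I) = h(∏ F_Q^{k_Q})` and
   `h(√Q) = h(F_Q)` (Def. 4.5; `h(λF) = h(F)`).
2. Every `F_Q` is homogeneous of degree `deg √Q` in each block `uᵢ` (remark after Prop. 4.4), so
   setting `u_{i0} = 1` (`NesterenkoBlockDehom.lean`) keeps the coefficients, hence the heights, and
   commutes with the product; afterwards there are `r m` variables and `deg_{u_{ij}} F_Q ≤ deg √Q`.
3. Write each dehomogenised `F_Q` as `c_Q Z_Q` with `Z_Q` a PRIMITIVE integer polynomial
   (`NesterenkoIntegerHeights.lean`); then `∏ Z_Q^{k_Q}` is primitive (Gauss's lemma) and represents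
   the product, so `h(F_Q) = log max |coeff Z_Q|` and `h(I) = log max |coeff ∏ Z_Q^{k_Q}|`.
4. Gelfond's lemma (`gelfond_lower_linear_fintype`, Bombieri–Gubler Lemma 1.6.11 with the constant
   `e^{∑ partial degrees}`): `∑ k_Q log max|coeff Z_Q| ≤ log max|coeff ∏ Z_Q^{k_Q}| + ∑_v S_v` with
   `S_v = ∑_Q k_Q deg_v Z_Q ≤ ∑_Q k_Q deg √Q = deg I` (Prop. 4.7 1)) for each of the `r m ≤ m²`
   variables `v`. Hence `∑ k_Q h(√Q) ≤ h(I) + m² deg I`.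

## References

* [NesterenkoPhilippon2001] Yu. V. Nesterenko, P. Philippon (eds.), *Introduction to Algebraic
  Independence Theory*, LNM 1752, Springer 2001, Ch. 3 §4: Def. 4.2, Prop. 4.4, Def. 4.5,
  Prop. 4.7 2) (pp. 38–39; PDF pp. 50–51).
* [Nes10] Yu. V. Nesterenko, Proc. Steklov Inst. Math. 218 (1997) 294–331, Prop. 1.2.
* [BombieriGubler2006] E. Bombieri, W. Gubler, *Heights in Diophantine Geometry*, §1.6,
  Lemma 1.6.3, Lemma 1.6.11, Theorem 1.6.13.
-/

noncomputable section

open MvPolynomial Height Literature.NumberTheory.DiophantineGeometry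

namespace Literature.NumberTheory.Transcendental

namespace Nesterenko

/-! ### Gelfond's lemma for heights of primitive integer polynomials -/

/-- `deg_v` is unchanged by an injective change of coefficients. [folklore] -/
theorem degreeOf_map_of_injective {σ R S : Type*} [CommSemiring R] [CommSemiring S]
    (p : MvPolynomial σ R) {f : R →+* S} (hf : Function.Injective f) (v : σ) :
    degreeOf v (map f p) = degreeOf v p := by
  classical
  rw [degreeOf_eq_sup, degreeOf_eq_sup, support_map_of_injective p hf]

/-- `deg_v` only depends on the support. [folklore] -/
theorem degreeOf_eq_of_support_eq {σ R S : Type*} [CommSemiring R] [CommSemiring S]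
    {p : MvPolynomial σ R} {q : MvPolynomial σ S} (h : p.support = q.support) (v : σ) :
    degreeOf v p = degreeOf v q := by
  classical
  rw [degreeOf_eq_sup, degreeOf_eq_sup, h]

/-- **Heights of products, lower bound** (Gauss + Gelfond; Bombieri–Gubler Theorem 1.6.13 over `ℚ`
with the constant `e^{d}`): for PRIMITIVE integer polynomials `Z_j` and exponents `k_j`,
`∑_j k_j h(Z_j) ≤ h(∏_j Z_j^{k_j}) + ∑_v ∑_j k_j deg_v Z_j`.
[cite: BombieriGubler2006, §1.6, Theorem 1.6.13 (p. 28)] -/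
theorem sum_mul_height_map_le {σ ι : Type*} [Fintype σ] [DecidableEq σ] (s : Finset ι)
    (k : ι → ℕ) (Z : ι → MvPolynomial σ ℤ)
    (hZ : ∀ j ∈ s, (Z j).support.gcd (fun γ => coeff γ (Z j)) = 1) :
    ∑ j ∈ s, (k j : ℝ) * height (map (Int.castRingHom ℚ) (Z j)) ≤
      height (map (Int.castRingHom ℚ) (∏ j ∈ s, Z j ^ k j)) +
        ∑ v, (∑ j ∈ s, (k j * degreeOf v (Z j) : ℕ) : ℝ) := by
  classical
  have hZ0 : ∀ j ∈ s, Z j ≠ 0 := fun j hj => ne_zero_of_gcd_coeff_eq_one (hZ j hj)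
  -- a coefficient of maximal modulus of each `Z_j`
  have hmax : ∀ j ∈ s, ∃ γ ∈ (Z j).support, ∀ δ ∈ (Z j).support, |coeff δ (Z j)| ≤ |coeff γ (Z j)| :=
    fun j hj => Finset.exists_max_image _ (fun δ => |coeff δ (Z j)|)
      (by rw [Finset.nonempty_iff_ne_empty, Ne, support_eq_empty]; exact hZ0 j hj)
  choose! γ hγ hγmax using hmax
  have hhZ : ∀ j ∈ s, height (map (Int.castRingHom ℚ) (Z j)) =
      Real.log (|coeff (γ j) (Z j)| : ℤ) :=
    fun j hj => height_map_eq_log_abs_coeff (Z j) (hZ j hj) (hγ j hj) (hγmax j hj)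
  -- the product is primitive
  set W : MvPolynomial σ ℤ := ∏ j ∈ s, Z j ^ k j with hW
  have hWprim : W.support.gcd (fun δ => coeff δ W) = 1 :=
    gcd_coeff_prod_eq_one s (fun j => Z j ^ k j) fun j hj => gcd_coeff_pow_eq_one (hZ j hj) (k j)
  -- Gelfond's lemma over `ℂ`, with the index set `Σ j, range (k j)` (each `Z_j` repeated `k_j` times)
  set ZC : ι → MvPolynomial σ ℂ := fun j => map (Int.castRingHom ℂ) (Z j) with hZC
  have hinjC : Function.Injective (Int.castRingHom ℂ) := Int.cast_injective
  have hZC0 : ∀ x ∈ s.sigma (fun j => Finset.range (k j)), ZC x.1 ≠ 0 := fun x hx h =>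
    hZ0 x.1 (Finset.mem_sigma.mp hx).1 (map_injective _ hinjC (by rw [map_zero]; exact h))
  have hcoeffC : ∀ x ∈ s.sigma (fun j => Finset.range (k j)), coeff (γ x.1) (ZC x.1) ≠ 0 := by
    intro x hx
    rw [hZC, coeff_map, eq_intCast, Int.cast_ne_zero]
    exact mem_support_iff.mp (hγ x.1 (Finset.mem_sigma.mp hx).1)
  obtain ⟨e', he', hle⟩ := gelfond_lower_linear_fintype (s.sigma fun j => Finset.range (k j))
    (fun x => ZC x.1) hZC0 (fun x => γ x.1) hcoeffC
  -- identify the product with `map W`, the left sum with `∑ k_j h(Z_j)`, the degrees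
  have hprodC : ∏ x ∈ s.sigma (fun j => Finset.range (k j)), ZC x.1 = map (Int.castRingHom ℂ) W := by
    rw [Finset.prod_sigma, hW, map_prod]
    refine Finset.prod_congr rfl fun j _ => ?_
    simp only [Finset.prod_const, Finset.card_range, map_pow, hZC]
  rw [hprodC] at he' hle
  have hsumC : ∑ x ∈ s.sigma (fun j => Finset.range (k j)), Real.log ‖coeff (γ x.1) (ZC x.1)‖ =
      ∑ j ∈ s, (k j : ℝ) * height (map (Int.castRingHom ℚ) (Z j)) := by
    rw [Finset.sum_sigma]
    refine Finset.sum_congr rfl fun j hj => ?_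
    simp only [Finset.sum_const, Finset.card_range, nsmul_eq_mul]
    rw [hhZ j hj, hZC, coeff_map, eq_intCast, Complex.norm_intCast, Int.cast_abs]
  rw [hsumC] at hle
  have hdegC : ∑ v, (∑ x ∈ s.sigma (fun j => Finset.range (k j)), degreeOf v (ZC x.1) : ℝ) =
      ∑ v, (∑ j ∈ s, (k j * degreeOf v (Z j) : ℕ) : ℝ) := by
    refine Finset.sum_congr rfl fun v _ => ?_
    rw [Finset.sum_sigma]
    push_cast
    refine Finset.sum_congr rfl fun j _ => ?_
    simp only [Finset.sum_const, Finset.card_range, nsmul_eq_mul]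
    rw [hZC, degreeOf_map_of_injective _ hinjC]
  rw [hdegC] at hle
  -- the chosen coefficient of the product is bounded by `h(W)`
  have he'W : e' ∈ W.support := by rwa [support_map_of_injective W hinjC] at he'
  have hcoeffW : Real.log ‖coeff e' (map (Int.castRingHom ℂ) W)‖ ≤
      height (map (Int.castRingHom ℚ) W) := by
    rw [coeff_map, eq_intCast, Complex.norm_intCast, ← Int.cast_abs]
    exact log_abs_coeff_le_height_map W hWprim he'W
  linarith

/-! ### Proposition 4.7 2) -/

variable {m : ℕ}

/-- The number of `u`-variables left after dehomogenising one per block is `r m`. [folklore] -/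
theorem card_blockVars (r m : ℕ) :
    Fintype.card (Fin r × {a : Fin (m + 1) // a ≠ 0}) = r * m := by
  rw [Fintype.card_prod, Fintype.card_fin, Fintype.card_subtype, Finset.filter_ne',
    Finset.card_erase_of_mem (Finset.mem_univ _), Finset.card_univ, Fintype.card_fin,
    Nat.add_sub_cancel]

/-- **LNM 1752 Ch. 3 Proposition 4.7 2)** (heights; from Proposition 4.4). Let
`I ⊂ ℚ[x₀, …, x_m]` be a homogeneous unmixed ideal with `dim I = r − 1`, `1 ≤ r ≤ m`, `t` its
reduced primary decomposition, `k_Q` the exponent of `Q ∈ t`. Then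
`∑_{Q ∈ t} k_Q h(√Q) ≤ h(I) + m² deg I` (`ν = 1` for `K = ℚ`). See the module docstring for the
proof (Prop. 4.4, dehomogenisation, Gauss's lemma, Gelfond's lemma).
[cite: NesterenkoPhilippon2001, Ch. 3 Prop. 4.7 2) (p. 39)] -/
theorem sum_primaryExponent_mul_iheight_le (h44 : NesterenkoPhilippon2001_ch3_prop_4_4) {r : ℕ}
    {I : Ideal (Rx m)} (hr1 : 1 ≤ r) (hrm : r ≤ m)
    (hIh : letI := MvPolynomial.gradedAlgebra (σ := Fin (m + 1)) (R := ℚ)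
      I.IsHomogeneous (homogeneousSubmodule (Fin (m + 1)) ℚ)) (hI : IsUnmixedOfRank I r)
    {t : Finset (Ideal (Rx m))} (ht : Submodule.IsMinimalPrimaryDecomposition I t) :
    ∑ Q ∈ t, (primaryExponent Q : ℝ) * iheight Q.radical r ≤
      iheight I r + (m : ℝ) ^ 2 * ideg I r := by
  classical
  have hr : 0 < r := hr1
  obtain ⟨hne, c, hc, hprod⟩ := exists_chowForm_eq_C_mul_prod h44 hr1 hrm hIh hI ht
  have hdeg := sum_primaryExponent_mul_ideg_eq h44 hr1 hrm hIh hI ht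
  -- notation: the factors, their block degrees, the product
  set Fj : Ideal (Rx m) → RU r m := fun Q => chowForm Q.radical r with hFj
  set D : Ideal (Rx m) → ℕ := fun Q => ideg Q.radical r with hD
  set G : RU r m := ∏ Q ∈ t, Fj Q ^ primaryExponent Q with hG
  -- block-homogeneity of the factors and of `G`
  have hblk : ∀ Q, ∀ e ∈ (Fj Q).support, ∀ i : Fin r, ∑ a, e (i, a) = D Q :=
    fun Q e he i => bdeg_eq_ideg_of_mem_support_chowForm Q.radical hr he i
  have hGsupp : G.support = (chowForm I r).support := by
    have hG' : G = C c⁻¹ * chowForm I r := by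
      rw [hprod, ← mul_assoc, ← C_mul, inv_mul_cancel₀ hc, C_1, one_mul]
    rw [hG', C_mul', support_smul_eq (inv_ne_zero hc)]
  have hblkG : ∀ e ∈ G.support, ∀ i : Fin r, ∑ a, e (i, a) = ideg I r := fun e he i =>
    bdeg_eq_ideg_of_mem_support_chowForm I hr (hGsupp ▸ he) i
  -- step 1: heights of `I` and of the `√Q` are heights of `G` and of the `F_Q`
  have hI_eq : iheight I r = height G := by
    change height (chowForm I r) = height G
    rw [hprod, height_C_mul hc]
  -- step 2: dehomogenise (`u_{i0} = 1`)
  set a₀ : Fin (m + 1) := 0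
  have hinjF : ∀ Q, Set.InjOn (dehomIdx (r := r) a₀) (Fj Q).support := fun Q =>
    injOn_dehomIdx a₀ (S := ((Fj Q).support : Set _)) (D := fun _ => D Q) fun e he i => hblk Q e he i
  have hinjG : Set.InjOn (dehomIdx (r := r) a₀) G.support :=
    injOn_dehomIdx a₀ (S := (G.support : Set _)) (D := fun _ => ideg I r) fun e he i => hblkG e he i
  set Fd : Ideal (Rx m) → MvPolynomial (Fin r × {a : Fin (m + 1) // a ≠ a₀}) ℚ :=
    fun Q => dehom ℚ a₀ (Fj Q) with hFd
  have hFd0 : ∀ Q ∈ t, Fd Q ≠ 0 := fun Q hQ => dehom_ne_zero a₀ (hinjF Q) (hne Q hQ)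
  have hFd_height : ∀ Q, height (Fd Q) = iheight Q.radical r := fun Q =>
    height_dehom a₀ (Fj Q) (hinjF Q)
  have hFd_deg : ∀ Q (v : Fin r × {a : Fin (m + 1) // a ≠ a₀}), degreeOf v (Fd Q) ≤ D Q :=
    fun Q v => degreeOf_dehom_le a₀ (Fj Q) (D := fun _ => D Q) (hblk Q) v.1 v.2
  have hGd : dehom ℚ a₀ G = ∏ Q ∈ t, Fd Q ^ primaryExponent Q := by
    rw [hG, map_prod]
    exact Finset.prod_congr rfl fun Q _ => by rw [map_pow]
  have hGd_height : height (dehom ℚ a₀ G) = height G := height_dehom a₀ G hinjG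
  -- step 3: primitive integer representatives of the dehomogenised factors
  have hrep : ∀ Q ∈ t, ∃ cQ : ℚ, cQ ≠ 0 ∧ ∃ Z : MvPolynomial (Fin r × {a : Fin (m + 1) // a ≠ a₀}) ℤ,
      Fd Q = C cQ * map (Int.castRingHom ℚ) Z ∧ Z.support = (Fd Q).support ∧
        Z.support.gcd (fun γ => coeff γ Z) = 1 :=
    fun Q hQ => exists_eq_C_mul_map_primitive (Fd Q) (hFd0 Q hQ)
  choose! cQ hcQ Z hZeq hZsupp hZprim using hrep
  -- the product: `dehom G = C (∏ cQ^k) * map (∏ Z^k)`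
  have hprodZ : dehom ℚ a₀ G = C (∏ Q ∈ t, cQ Q ^ primaryExponent Q) *
      map (Int.castRingHom ℚ) (∏ Q ∈ t, Z Q ^ primaryExponent Q) := by
    rw [hGd, map_prod C, map_prod (map (Int.castRingHom ℚ)), ← Finset.prod_mul_distrib]
    refine Finset.prod_congr rfl fun Q hQ => ?_
    rw [map_pow, map_pow, ← mul_pow, ← hZeq Q hQ]
  have hcprod : ∏ Q ∈ t, cQ Q ^ primaryExponent Q ≠ 0 :=
    Finset.prod_ne_zero_iff.mpr fun Q hQ => pow_ne_zero _ (hcQ Q hQ)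
  have hW_height : height (map (Int.castRingHom ℚ) (∏ Q ∈ t, Z Q ^ primaryExponent Q)) =
      iheight I r := by
    rw [hI_eq, ← hGd_height, hprodZ, height_C_mul hcprod]
  have hZ_height : ∀ Q ∈ t, height (map (Int.castRingHom ℚ) (Z Q)) = iheight Q.radical r := by
    intro Q hQ
    rw [← hFd_height Q, hZeq Q hQ, height_C_mul (hcQ Q hQ)]
  have hZ_deg : ∀ Q ∈ t, ∀ v, degreeOf v (Z Q) ≤ D Q := fun Q hQ v =>
    (degreeOf_eq_of_support_eq (hZsupp Q hQ) v).trans_le (hFd_deg Q v)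
  -- step 4: Gelfond's lemma
  have hmain := sum_mul_height_map_le t (fun Q => primaryExponent Q) Z hZprim
  rw [hW_height] at hmain
  have hsum_eq : ∑ Q ∈ t, (primaryExponent Q : ℝ) * height (map (Int.castRingHom ℚ) (Z Q)) =
      ∑ Q ∈ t, (primaryExponent Q : ℝ) * iheight Q.radical r :=
    Finset.sum_congr rfl fun Q hQ => by rw [hZ_height Q hQ]
  rw [hsum_eq] at hmain
  -- the loss: `∑_v ∑_Q k_Q deg_v Z_Q ≤ (r m) deg I ≤ m² deg I`
  have hloss : ∑ v : Fin r × {a : Fin (m + 1) // a ≠ a₀},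
      (∑ Q ∈ t, (primaryExponent Q * degreeOf v (Z Q) : ℕ) : ℝ) ≤ (m : ℝ) ^ 2 * ideg I r := by
    have h1 : ∀ v : Fin r × {a : Fin (m + 1) // a ≠ a₀},
        (∑ Q ∈ t, (primaryExponent Q * degreeOf v (Z Q) : ℕ) : ℝ) ≤ ideg I r := by
      intro v
      rw [← hdeg]
      push_cast
      exact Finset.sum_le_sum fun Q hQ => by
        have := hZ_deg Q hQ v
        have hk : (0 : ℝ) ≤ primaryExponent Q := Nat.cast_nonneg _
        exact mul_le_mul_of_nonneg_left (by exact_mod_cast this) hk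
    calc ∑ v : Fin r × {a : Fin (m + 1) // a ≠ a₀},
          (∑ Q ∈ t, (primaryExponent Q * degreeOf v (Z Q) : ℕ) : ℝ)
        ≤ ∑ _v : Fin r × {a : Fin (m + 1) // a ≠ a₀}, (ideg I r : ℝ) :=
          Finset.sum_le_sum fun v _ => h1 v
      _ = (r * m : ℕ) * ideg I r := by
          rw [Finset.sum_const, Finset.card_univ, card_blockVars, nsmul_eq_mul]
      _ ≤ (m : ℝ) ^ 2 * ideg I r := by
          have hrm' : (r : ℝ) ≤ m := by exact_mod_cast hrm
          have hD : (0 : ℝ) ≤ ideg I r := Nat.cast_nonneg _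
          have hrm2 : (r : ℝ) * m ≤ m * m := mul_le_mul_of_nonneg_right hrm' (Nat.cast_nonneg m)
          push_cast
          calc (r : ℝ) * m * ideg I r ≤ m * m * ideg I r := mul_le_mul_of_nonneg_right hrm2 hD
            _ = (m : ℝ) ^ 2 * ideg I r := by ring
  linarith

end Nesterenko

end Literature.NumberTheory.Transcendental

end
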